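import Summits.NavierStokesRegularity.NavierStokesRegularity.Theses.SelfMixingDichotomy
import Summits.NavierStokesRegularity.NavierStokesRegularity.Theorems.SelfMixingDichotomySequentialTypeIExclusionWindowsForceTypeILogDense
import Literature.Analysis.FluidPDE.LerayHopfAssociatedPressure

/-!
# Crux `SelfMixingDichotomy.SequentialTypeIExclusion` (stmt-NavierStokesRegularity-1424), line `registered`:
  the liminf burden of S1 moved to the route's payoff — a QUANTITATIVE mixing payoff densifies the
  Type-I windows (helper file, `--supports`)

The registered open stub `stub_windowsForceTypeI` of the line asks that Type-I windows at arbitrarily small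
scales (`liminf_{r→0} C(r; T, x₀) ≤ M`) force a centred cubic Type-I bound (`limsup < ∞`) — "no
scale-intermittency", an unnamed open regularity mechanism (leads 0, c1, c2: its provable corners are the
log-dense windows, p156105, and the 3/2 gap-growth law, p158624). The crux S1 needs it only because the route's
Assembly (pure-logic trichotomy mixing / non-mixing high-Re / low-Re per scale) FORGETS where the low-Reynolds
windows come from. This file shows, sorry-free, that the burden can be carried instead by a quantitative,
finite-depth form of the route's OWN payoff crux P (`MixingPayoff`):

  P_quant: ∃ δ > 0 ∀ M ∃ K ≥ 2: for every classical Leray–Hopf solution (ν = 1) from a rapidly decaying datum,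
  every x₀ and every scale 0 < r, r² ≤ T with C(r; T, x₀) ≤ M: if every scale ρ ∈ [r/K, r) of Reynolds
  number C(ρ) ≥ M is δ-mixing (MIX(u, T, x₀, ρ, δ), the scalar dissipation factor of the route), then some
  scale ρ ∈ [r/K, r/2] has C(ρ) ≤ M again

("below a bounded-Reynolds scale, a K-band whose high-Reynolds members all mix contains another
bounded-Reynolds scale": sustained high-Reynolds mixing right below a Type-I window cannot last K scales).

* `cknC_lt_top_of_isLerayHopfOn` — `C(r; T, x₀) < ∞` for a Leray–Hopf solution and `0 < r`, `r² ≤ T`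
  (`u ∈ L³` of the slab, `IsLerayHopfOn.memLp_three_uncurry_slab`);
* `bdd_of_quantMixingPayoff` — **P_quant ∧ CoherentScaleExclusion (S2, as filed) ∧ sup-form of S1 ⇒ BDD at
  every final-time point** of every solution of the class: S2 makes every high-Reynolds scale below some `r₀`
  mix; starting from any scale `r_s < r₀` (a window for `M₀ = max(M, C(r_s))`), P_quant produces a window in
  `[w/K, w/2]` below every window `w`, i.e. a LOG-DENSE sequence of windows, whence the centred Type-I bound
  `C ≤ K² M₀` on `(0, r_s)` by the landed `cknC_typeI_of_logDenseSeq` (p156105), and the sup-form concludes.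

With `supForm_of_not_typeISingularityExists` (file `…SequentialTypeIExclusionStructure.lean`) and the closed
items `LocalToGlobal`, `NoBlowupToClay` this gives `NavierStokesRegularity ⇐ P_quant ∧ S2 ∧ ¬TypeISingularityExists`
(file `…SequentialTypeIExclusionQuantPayoffSummit.lean`): the unnamed mechanism disappears from the route
without a new crux, at the price of making P quantitative (P_quant neither implies nor is implied by P as filed;
P ⇐ P_quant ∧ sup-form by the same descent).
-/

noncomputable section

-- the summit and its single problem share the name (D-0017 nested layout)
set_option linter.dupNamespace false

namespace Summit.NavierStokesRegularity.NavierStokesRegularity.Theorems.SequentialTypeIExclusion.Registered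

open scoped ENNReal NNReal Topology
open Literature.Analysis.FluidPDE Set Filter MeasureTheory Function Metric

/-- **`C(r; T, x₀) < ∞` for a Leray–Hopf weak solution** on `ℝ³ × [0, T)` and a backward cylinder inside the
slab (`0 < r`, `r² ≤ T`): `u ∈ L³((0,T) × ℝ³)` (`IsLerayHopfOn.memLp_three_uncurry_slab`, interpolation of the
energy class) and `Q_r(T, x₀) ⊆ (0, T) × ℝ³`. -/
theorem cknC_lt_top_of_isLerayHopfOn : ∀ T : ℝ, ∀ (ν : ℝ) (f : ℝ → EuclideanSpace ℝ (Fin 3) → EuclideanSpace ℝ (Fin 3)) (u₀ : EuclideanSpace ℝ (Fin 3) → EuclideanSpace ℝ (Fin 3)) (u : ℝ → EuclideanSpace ℝ (Fin 3) → EuclideanSpace ℝ (Fin 3)), Literature.Analysis.FluidPDE.IsLerayHopfOn T ν f u₀ u → ∀ x₀ : EuclideanSpace ℝ (Fin 3), ∀ r : ℝ, 0 < r → r ^ 2 ≤ T → Literature.Analysis.FluidPDE.cknC r ((T, x₀) : ℝ × EuclideanSpace ℝ (Fin 3)) u < ⊤ := by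
  intro T ν f u₀ u hLH x₀ r hr hrT
  have hmem := hLH.memLp_three_uncurry_slab
  have h3 : ∫⁻ z, ‖uncurry u z‖ₑ ^ (3 : ℝ≥0∞).toReal
      ∂(volume.restrict (Ioo 0 T ×ˢ (univ : Set (EuclideanSpace ℝ (Fin 3))))) < ⊤ :=
    lintegral_rpow_enorm_lt_top_of_eLpNorm_lt_top (by norm_num) (by norm_num) hmem.eLpNorm_lt_top
  have hsub : parabolicCylinder r ((T, x₀) : ℝ × EuclideanSpace ℝ (Fin 3)) ⊆
      Ioo 0 T ×ˢ (univ : Set (EuclideanSpace ℝ (Fin 3))) := by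
    intro w hw
    simp only [mem_parabolicCylinder] at hw
    exact ⟨⟨by linarith [hw.1.1], hw.1.2⟩, mem_univ _⟩
  have hpow : ∀ z : ℝ × EuclideanSpace ℝ (Fin 3),
      ‖u z.1 z.2‖ₑ ^ (3 : ℕ) = ‖uncurry u z‖ₑ ^ (3 : ℝ≥0∞).toReal := by
    intro z
    rw [ENNReal.toReal_ofNat, ← ENNReal.rpow_natCast]
    norm_num [Function.uncurry]
  have hint : ∫⁻ q in parabolicCylinder r ((T, x₀) : ℝ × EuclideanSpace ℝ (Fin 3)), ‖u q.1 q.2‖ₑ ^ (3 : ℕ) < ⊤ := by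
    calc ∫⁻ q in parabolicCylinder r ((T, x₀) : ℝ × EuclideanSpace ℝ (Fin 3)), ‖u q.1 q.2‖ₑ ^ (3 : ℕ)
        = ∫⁻ q in parabolicCylinder r ((T, x₀) : ℝ × EuclideanSpace ℝ (Fin 3)),
            ‖uncurry u q‖ₑ ^ (3 : ℝ≥0∞).toReal := lintegral_congr fun z => hpow z
      _ ≤ ∫⁻ z, ‖uncurry u z‖ₑ ^ (3 : ℝ≥0∞).toReal
            ∂(volume.restrict (Ioo 0 T ×ˢ (univ : Set (EuclideanSpace ℝ (Fin 3))))) :=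
          lintegral_mono_set hsub
      _ < ⊤ := h3
  unfold cknC
  refine ENNReal.mul_lt_top ?_ hint
  exact ENNReal.inv_lt_top.2 (ENNReal.pow_pos (ENNReal.ofReal_pos.2 hr) 2)

/-- **The descent (pure bookkeeping about the function `r ↦ C(r; T, x₀)`).** If `C(r_s) ≤ M₀` and below every
window `w ≤ r_s` (`C(w) ≤ M₀`) there is a window in `[w/K, w/2]` (`K > 0`), then the windows are log-dense below
`r_s` and `C(ρ) ≤ K² M₀` for every `0 < ρ < r_s` (iterate from `w₀ = r_s`: `w_n → 0`, `w_n ≤ K w_{n+1}`; then the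
landed `cknC_typeI_of_logDenseSeq`, p156105). -/
theorem cknC_typeI_of_windowStep
    (u : ℝ → EuclideanSpace ℝ (Fin 3) → EuclideanSpace ℝ (Fin 3)) (x₀ : EuclideanSpace ℝ (Fin 3))
    (T M₀ K rs : ℝ) (hK : 0 < K) (hrs : 0 < rs)
    (hM₀ : Literature.Analysis.FluidPDE.cknC rs ((T, x₀) : ℝ × EuclideanSpace ℝ (Fin 3)) u ≤ ENNReal.ofReal M₀)
    (step : ∀ w : ℝ, 0 < w → w ≤ rs →
      Literature.Analysis.FluidPDE.cknC w ((T, x₀) : ℝ × EuclideanSpace ℝ (Fin 3)) u ≤ ENNReal.ofReal M₀ →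
      ∃ w' ∈ Set.Icc (w / K) (w / 2),
        Literature.Analysis.FluidPDE.cknC w' ((T, x₀) : ℝ × EuclideanSpace ℝ (Fin 3)) u ≤ ENNReal.ofReal M₀) :
    ∀ ρ ∈ Set.Ioo 0 rs,
      Literature.Analysis.FluidPDE.cknC ρ ((T, x₀) : ℝ × EuclideanSpace ℝ (Fin 3)) u ≤ ENNReal.ofReal (K ^ 2 * M₀) := by
  -- the descent sequence of windows
  have next : ∀ s : {w : ℝ // 0 < w ∧ w ≤ rs ∧
      Literature.Analysis.FluidPDE.cknC w ((T, x₀) : ℝ × EuclideanSpace ℝ (Fin 3)) u ≤ ENNReal.ofReal M₀},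
      ∃ s' : {w : ℝ // 0 < w ∧ w ≤ rs ∧
        Literature.Analysis.FluidPDE.cknC w ((T, x₀) : ℝ × EuclideanSpace ℝ (Fin 3)) u ≤ ENNReal.ofReal M₀},
        s'.1 ∈ Set.Icc (s.1 / K) (s.1 / 2) := by
    rintro ⟨w, hw, hws, hCw⟩
    obtain ⟨w', hw', hC'⟩ := step w hw hws hCw
    have hw'pos : 0 < w' := lt_of_lt_of_le (div_pos hw hK) hw'.1
    have hw's : w' ≤ rs := hw'.2.trans (by linarith)
    exact ⟨⟨w', hw'pos, hw's, hC'⟩, hw'⟩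
  choose F hF using next
  set seq : ℕ → {w : ℝ // 0 < w ∧ w ≤ rs ∧
      Literature.Analysis.FluidPDE.cknC w ((T, x₀) : ℝ × EuclideanSpace ℝ (Fin 3)) u ≤ ENNReal.ofReal M₀} :=
    fun n => F^[n] ⟨rs, hrs, le_rfl, hM₀⟩ with hseq_def
  set w : ℕ → ℝ := fun n => (seq n).1 with hw_def
  have hseq_succ : ∀ n, seq (n + 1) = F (seq n) := fun n => Function.iterate_succ_apply' F n _
  have hw_succ : ∀ n, w (n + 1) ∈ Set.Icc (w n / K) (w n / 2) := by
    intro n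
    show (seq (n + 1)).1 ∈ Set.Icc ((seq n).1 / K) ((seq n).1 / 2)
    rw [hseq_succ]
    exact hF (seq n)
  have hwpos : ∀ n, 0 < w n := fun n => (seq n).2.1
  have hwin : ∀ n,
      Literature.Analysis.FluidPDE.cknC (w n) ((T, x₀) : ℝ × EuclideanSpace ℝ (Fin 3)) u ≤ ENNReal.ofReal M₀ :=
    fun n => (seq n).2.2.2
  have hw0 : w 0 = rs := rfl
  have hgap : ∀ n, w n ≤ K * w (n + 1) := by
    intro n
    have h := (hw_succ n).1
    rw [div_le_iff₀ hK] at h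
    linarith [mul_comm (w (n + 1)) K]
  have hle : ∀ n, w n ≤ rs * (1 / 2) ^ n := by
    intro n
    induction n with
    | zero => simp [hw0]
    | succ n ih =>
        calc w (n + 1) ≤ w n / 2 := (hw_succ n).2
          _ ≤ rs * (1 / 2) ^ n / 2 := by linarith
          _ = rs * (1 / 2) ^ (n + 1) := by ring
  have hlim : Tendsto w atTop (𝓝 0) := by
    have h1 : Tendsto (fun n : ℕ => rs * (1 / 2 : ℝ) ^ n) atTop (𝓝 (rs * 0)) :=
      (tendsto_pow_atTop_nhds_zero_of_lt_one (by norm_num) (by norm_num)).const_mul rs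
    rw [mul_zero] at h1
    exact tendsto_of_tendsto_of_tendsto_of_le_of_le tendsto_const_nhds h1 (fun n => (hwpos n).le) hle
  -- log-dense windows force the centred Type-I bound `C ≤ K² M₀` on `(0, r_s)` (p156105)
  have hTI := cknC_typeI_of_logDenseSeq u x₀ T M₀ K w hwpos hgap hlim hwin
  rwa [hw0] at hTI

/-- **A quantitative mixing payoff densifies the Type-I windows: P_quant ∧ S2 ∧ (sup-form of S1) ⇒ local
boundedness at every final-time point.** Fix `δ` from P_quant and `M` from S2(δ); at a point where `u` is NOT
bounded, S2 says every scale `ρ < r₀` with `C(ρ) ≥ M` is δ-mixing. Take `r_s = min(r₀/2, √T)`,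
`M₀ = max(M, C(r_s))` (finite, `cknC_lt_top_of_isLerayHopfOn`) and `K = K(M₀)` from P_quant. Below every window
`w ≤ r_s` (`C(w) ≤ M₀`) the band `[w/K, w)` satisfies P_quant's hypothesis, so there is a window in `[w/K, w/2]`;
the descent `cknC_typeI_of_windowStep` gives `C ≤ K² M₀` on `(0, r_s)`, and the sup-form gives boundedness —
contradiction. No use is made of `MixingPayoff` (P as filed) nor of the liminf-form S1. -/
theorem bdd_of_quantMixingPayoff : (∃ δ : ℝ, 0 < δ ∧ ∀ M : ℝ, ∃ K : ℝ, 2 ≤ K ∧ ∀ T : ℝ, 0 < T → ∀ (u : ℝ → EuclideanSpace ℝ (Fin 3) → EuclideanSpace ℝ (Fin 3)) (p : ℝ → EuclideanSpace ℝ (Fin 3) → ℝ), Literature.Analysis.FluidPDE.IsClassicalNSSolutionOn (Set.Ico 0 T) 1 0 u p → Literature.Analysis.FluidPDE.IsLerayHopfOn T 1 0 (u 0) u → Literature.Analysis.FluidPDE.HasRapidSpatialDecay (u 0) → ∀ x₀ : EuclideanSpace ℝ (Fin 3), ∀ r : ℝ, 0 < r → r ^ 2 ≤ T → Literature.Analysis.FluidPDE.cknC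 r ((T, x₀) : ℝ × EuclideanSpace ℝ (Fin 3)) u ≤ ENNReal.ofReal M → (∀ ρ ∈ Set.Ico (r / K) r, ENNReal.ofReal M ≤ Literature.Analysis.FluidPDE.cknC ρ ((T, x₀) : ℝ × EuclideanSpace ℝ (Fin 3)) u → (∀ θ : ℝ → EuclideanSpace ℝ (Fin 3) → ℝ, Literature.Analysis.FluidPDE.IsSmoothSpaceTimeOn (Set.Icc (T - ρ ^ 2) (T - ρ ^ 2 / 2)) θ → Literature.Analysis.FluidPDE.HasUniformRapidDecayOn (Set.Icc (T - ρ ^ 2) (T - ρ ^ 2 / 2)) θ → (∀ t ∈ (Set.Icc (T - ρ ^ 2) (T - ρ ^ 2 / 2)), ∀ x : EuclideanSpace ℝ (Fin 3), Literature.Analysis.FluidPDE.timeDerivWithin (Set.Icc (T - ρ ^ 2) (T - ρ ^ 2 / 2)) θ t x + inner ℝ (u t x) (gradient (θ t) x) = Laplacian.laplacian (θ t) x) → Function.support (θ (T - ρ ^ 2)) ⊆ Metric.ball x₀ ρ → ∫ x, (θ (T - ρ ^ 2 / 2) x) ^ 2 ≤ δ ^ 2 * ∫ x, (θ (T - ρ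 ^ 2) x) ^ 2)) → ∃ ρ ∈ Set.Icc (r / K) (r / 2), Literature.Analysis.FluidPDE.cknC ρ ((T, x₀) : ℝ × EuclideanSpace ℝ (Fin 3)) u ≤ ENNReal.ofReal M) → Summit.NavierStokesRegularity.NavierStokesRegularity.Theses.SelfMixingDichotomy.CoherentScaleExclusion → (∀ M : ℝ, ∀ T : ℝ, 0 < T → ∀ (u : ℝ → EuclideanSpace ℝ (Fin 3) → EuclideanSpace ℝ (Fin 3)) (p : ℝ → EuclideanSpace ℝ (Fin 3) → ℝ), Literature.Analysis.FluidPDE.IsClassicalNSSolutionOn (Set.Ico 0 T) 1 0 u p → Literature.Analysis.FluidPDE.IsLerayHopfOn T 1 0 (u 0) u → Literature.Analysis.FluidPDE.HasRapidSpatialDecay (u 0) → ∀ x₀ : EuclideanSpace ℝ (Fin 3), (∃ r₁ : ℝ, 0 < r₁ ∧ ∀ r ∈ Set.Ioo 0 r₁, Literature.Analysis.FluidPDE.cknC r ((T, x₀) : ℝ × EuclideanSpace ℝ (Fin 3)) u ≤ ENNReal.ofReal M) → ∃ ρ : ℝ, 0 < ρ ∧ ∃ M : ℝ, ∀ t ∈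 Set.Ioo (T - ρ ^ 2) T, ∀ x ∈ Metric.ball x₀ ρ, ‖u t x‖ ≤ M) → ∀ T : ℝ, 0 < T → ∀ (u : ℝ → EuclideanSpace ℝ (Fin 3) → EuclideanSpace ℝ (Fin 3)) (p : ℝ → EuclideanSpace ℝ (Fin 3) → ℝ), Literature.Analysis.FluidPDE.IsClassicalNSSolutionOn (Set.Ico 0 T) 1 0 u p → Literature.Analysis.FluidPDE.IsLerayHopfOn T 1 0 (u 0) u → Literature.Analysis.FluidPDE.HasRapidSpatialDecay (u 0) → ∀ x₀ : EuclideanSpace ℝ (Fin 3), ∃ ρ : ℝ, 0 < ρ ∧ ∃ M : ℝ, ∀ t ∈ Set.Ioo (T - ρ ^ 2) T, ∀ x ∈ Metric.ball x₀ ρ, ‖u t x‖ ≤ M := by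
  intro hP hS2 hsup T hT u p hcl hLH hdec x₀
  obtain ⟨δ, hδ, hPδ⟩ := hP
  obtain ⟨M, hM⟩ := hS2 δ hδ
  by_contra hB
  -- S2 (contrapositive): below some `r₀`, every scale of Reynolds number `≥ M` is δ-mixing
  have h2 : ∃ r₀ : ℝ, 0 < r₀ ∧ ∀ ρ ∈ Set.Ioo 0 r₀,
      ENNReal.ofReal M ≤ Literature.Analysis.FluidPDE.cknC ρ ((T, x₀) : ℝ × EuclideanSpace ℝ (Fin 3)) u →
      (∀ θ : ℝ → EuclideanSpace ℝ (Fin 3) → ℝ, Literature.Analysis.FluidPDE.IsSmoothSpaceTimeOn (Set.Icc (T - ρ ^ 2) (T - ρ ^ 2 / 2)) θ → Literature.Analysis.FluidPDE.HasUniformRapidDecayOn (Set.Icc (T - ρ ^ 2) (T - ρ ^ 2 / 2)) θ → (∀ t ∈ (Set.Icc (T - ρ ^ 2) (T - ρ ^ 2 / 2)), ∀ x : EuclideanSpace ℝ (Fin 3), Literature.Analysis.FluidPDE.timeDerivWithin (Set.Icc (T - ρ ^ 2) (T - ρ ^ 2 / 2)) θ t x + inner ℝ (u t x) (gradient (θ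 t) x) = Laplacian.laplacian (θ t) x) → Function.support (θ (T - ρ ^ 2)) ⊆ Metric.ball x₀ ρ → ∫ x, (θ (T - ρ ^ 2 / 2) x) ^ 2 ≤ δ ^ 2 * ∫ x, (θ (T - ρ ^ 2) x) ^ 2) := by
    by_contra h
    refine hB (hM T hT u p hcl hLH hdec x₀ fun r₀ hr₀ => ?_)
    by_contra h'
    refine h ⟨r₀, hr₀, fun ρ hρ hMρ => ?_⟩
    by_contra hmix
    exact h' ⟨ρ, hρ, hMρ, hmix⟩
  obtain ⟨r₀, hr₀, hmix⟩ := h2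
  -- the top scale `r_s`
  obtain ⟨rs, hrs_pos, hrs_r₀, hrs_T⟩ : ∃ rs : ℝ, 0 < rs ∧ rs < r₀ ∧ rs ^ 2 ≤ T := by
    refine ⟨min (r₀ / 2) (Real.sqrt T), lt_min (by positivity) (Real.sqrt_pos.2 hT),
      lt_of_le_of_lt (min_le_left _ _) (by linarith), ?_⟩
    calc min (r₀ / 2) (Real.sqrt T) ^ 2 ≤ Real.sqrt T ^ 2 :=
          pow_le_pow_left₀ (le_min (by positivity) (Real.sqrt_nonneg T)) (min_le_right _ _) 2
      _ = T := Real.sq_sqrt hT.le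
  -- `M₀ = max (M, C(r_s))`, finite
  have hfin := cknC_lt_top_of_isLerayHopfOn T 1 0 (u 0) u hLH x₀ rs hrs_pos hrs_T
  set M₀ : ℝ := max M (Literature.Analysis.FluidPDE.cknC rs ((T, x₀) : ℝ × EuclideanSpace ℝ (Fin 3)) u).toReal
    with hM₀_def
  have hM₀ : Literature.Analysis.FluidPDE.cknC rs ((T, x₀) : ℝ × EuclideanSpace ℝ (Fin 3)) u ≤ ENNReal.ofReal M₀ := by
    rw [← ENNReal.ofReal_toReal hfin.ne]
    exact ENNReal.ofReal_le_ofReal (le_max_right _ _)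
  have hMM₀ : ENNReal.ofReal M ≤ ENNReal.ofReal M₀ := ENNReal.ofReal_le_ofReal (le_max_left _ _)
  obtain ⟨K, hK2, hPK⟩ := hPδ M₀
  have hK : 0 < K := by linarith
  -- one step of the descent: below a window `w ≤ r_s` there is a window in `[w/K, w/2]`
  have step : ∀ w : ℝ, 0 < w → w ≤ rs →
      Literature.Analysis.FluidPDE.cknC w ((T, x₀) : ℝ × EuclideanSpace ℝ (Fin 3)) u ≤ ENNReal.ofReal M₀ →
      ∃ w' ∈ Set.Icc (w / K) (w / 2),
        Literature.Analysis.FluidPDE.cknC w' ((T, x₀) : ℝ × EuclideanSpace ℝ (Fin 3)) u ≤ ENNReal.ofReal M₀ := by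
    intro w hw hws hCw
    refine hPK T hT u p hcl hLH hdec x₀ w hw ((pow_le_pow_left₀ hw.le hws 2).trans hrs_T) hCw ?_
    intro ρ hρ hMρ
    have hρpos : 0 < ρ := lt_of_lt_of_le (div_pos hw hK) hρ.1
    exact hmix ρ ⟨hρpos, lt_of_lt_of_le hρ.2 (hws.trans hrs_r₀.le)⟩ (hMM₀.trans hMρ)
  have hTI := cknC_typeI_of_windowStep u x₀ T M₀ K rs hK hrs_pos hM₀ step
  -- the sup-form of S1 gives boundedness
  exact hB (hsup (K ^ 2 * M₀) T hT u p hcl hLH hdec x₀ ⟨rs, hrs_pos, hTI⟩)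

/-- **The new thesis implies the old payoff crux: P ⇐ P_quant ∧ (sup-form of S1).** If EVERY scale below `r₀`
is δ-mixing (the hypothesis of `MixingPayoff`, with the `δ` of P_quant), the band hypothesis of P_quant holds
below every window `w < r₀`, so the same descent from `r_s = min(r₀/2, √T)`, `M₀ = C(r_s)` gives a centred
Type-I bound and the sup-form concludes. -/
theorem mixingPayoff_of_quantMixingPayoff_of_supForm : (∃ δ : ℝ, 0 < δ ∧ ∀ M : ℝ, ∃ K : ℝ, 2 ≤ K ∧ ∀ T : ℝ, 0 < T → ∀ (u : ℝ → EuclideanSpace ℝ (Fin 3) → EuclideanSpace ℝ (Fin 3)) (p : ℝ → EuclideanSpace ℝ (Fin 3) → ℝ), Literature.Analysis.FluidPDE.IsClassicalNSSolutionOn (Set.Ico 0 T) 1 0 u p → Literature.Analysis.FluidPDE.IsLerayHopfOn T 1 0 (u 0) u → Literature.Analysis.FluidPDE.HasRapidSpatialDecay (u 0) → ∀ x₀ : EuclideanSpace ℝ (Fin 3), ∀ r : ℝ, 0 < r → r ^ 2 ≤ T → Literature.Analysis.FluidPDE.cknC r ((T, x₀) : ℝ × EuclideanSpace ℝ (Fin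 3)) u ≤ ENNReal.ofReal M → (∀ ρ ∈ Set.Ico (r / K) r, ENNReal.ofReal M ≤ Literature.Analysis.FluidPDE.cknC ρ ((T, x₀) : ℝ × EuclideanSpace ℝ (Fin 3)) u → (∀ θ : ℝ → EuclideanSpace ℝ (Fin 3) → ℝ, Literature.Analysis.FluidPDE.IsSmoothSpaceTimeOn (Set.Icc (T - ρ ^ 2) (T - ρ ^ 2 / 2)) θ → Literature.Analysis.FluidPDE.HasUniformRapidDecayOn (Set.Icc (T - ρ ^ 2) (T - ρ ^ 2 / 2)) θ → (∀ t ∈ (Set.Icc (T - ρ ^ 2) (T - ρ ^ 2 / 2)), ∀ x : EuclideanSpace ℝ (Fin 3), Literature.Analysis.FluidPDE.timeDerivWithin (Set.Icc (T - ρ ^ 2) (T - ρ ^ 2 / 2)) θ t x + inner ℝ (u t x) (gradient (θ t) x) = Laplacian.laplacian (θ t) x) → Function.support (θ (T - ρ ^ 2)) ⊆ Metric.ball x₀ ρ → ∫ x, (θ (T - ρ ^ 2 / 2) x) ^ 2 ≤ δ ^ 2 * ∫ x, (θ (T - ρ ^ 2) x) ^ 2)) → ∃ ρ ∈ Set.Icc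 (r / K) (r / 2), Literature.Analysis.FluidPDE.cknC ρ ((T, x₀) : ℝ × EuclideanSpace ℝ (Fin 3)) u ≤ ENNReal.ofReal M) → (∀ M : ℝ, ∀ T : ℝ, 0 < T → ∀ (u : ℝ → EuclideanSpace ℝ (Fin 3) → EuclideanSpace ℝ (Fin 3)) (p : ℝ → EuclideanSpace ℝ (Fin 3) → ℝ), Literature.Analysis.FluidPDE.IsClassicalNSSolutionOn (Set.Ico 0 T) 1 0 u p → Literature.Analysis.FluidPDE.IsLerayHopfOn T 1 0 (u 0) u → Literature.Analysis.FluidPDE.HasRapidSpatialDecay (u 0) → ∀ x₀ : EuclideanSpace ℝ (Fin 3), (∃ r₁ : ℝ, 0 < r₁ ∧ ∀ r ∈ Set.Ioo 0 r₁, Literature.Analysis.FluidPDE.cknC r ((T, x₀) : ℝ × EuclideanSpace ℝ (Fin 3)) u ≤ ENNReal.ofReal M) → ∃ ρ : ℝ, 0 < ρ ∧ ∃ M : ℝ, ∀ t ∈ Set.Ioo (T - ρ ^ 2) T, ∀ x ∈ Metric.ball x₀ ρ, ‖u t x‖ ≤ M) → Summit.NavierStokesRegularity.NavierStokesRegularity.Theses.SelfMixingDichotomy.MixingPayoff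 := by
  intro hP hsup
  obtain ⟨δ, hδ, hPδ⟩ := hP
  refine ⟨δ, hδ, fun T hT u p hcl hLH hdec x₀ hmixall => ?_⟩
  obtain ⟨r₀, hr₀, hmix⟩ := hmixall
  -- the top scale `r_s`
  obtain ⟨rs, hrs_pos, hrs_r₀, hrs_T⟩ : ∃ rs : ℝ, 0 < rs ∧ rs < r₀ ∧ rs ^ 2 ≤ T := by
    refine ⟨min (r₀ / 2) (Real.sqrt T), lt_min (by positivity) (Real.sqrt_pos.2 hT),
      lt_of_le_of_lt (min_le_left _ _) (by linarith), ?_⟩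
    calc min (r₀ / 2) (Real.sqrt T) ^ 2 ≤ Real.sqrt T ^ 2 :=
          pow_le_pow_left₀ (le_min (by positivity) (Real.sqrt_nonneg T)) (min_le_right _ _) 2
      _ = T := Real.sq_sqrt hT.le
  have hfin := cknC_lt_top_of_isLerayHopfOn T 1 0 (u 0) u hLH x₀ rs hrs_pos hrs_T
  set M₀ : ℝ := (Literature.Analysis.FluidPDE.cknC rs ((T, x₀) : ℝ × EuclideanSpace ℝ (Fin 3)) u).toReal
    with hM₀_def
  have hM₀ : Literature.Analysis.FluidPDE.cknC rs ((T, x₀) : ℝ × EuclideanSpace ℝ (Fin 3)) u ≤ ENNReal.ofReal M₀ := by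
    rw [← ENNReal.ofReal_toReal hfin.ne]
  obtain ⟨K, hK2, hPK⟩ := hPδ M₀
  have hK : 0 < K := by linarith
  have step : ∀ w : ℝ, 0 < w → w ≤ rs →
      Literature.Analysis.FluidPDE.cknC w ((T, x₀) : ℝ × EuclideanSpace ℝ (Fin 3)) u ≤ ENNReal.ofReal M₀ →
      ∃ w' ∈ Set.Icc (w / K) (w / 2),
        Literature.Analysis.FluidPDE.cknC w' ((T, x₀) : ℝ × EuclideanSpace ℝ (Fin 3)) u ≤ ENNReal.ofReal M₀ := by
    intro w hw hws hCw
    refine hPK T hT u p hcl hLH hdec x₀ w hw ((pow_le_pow_left₀ hw.le hws 2).trans hrs_T) hCw ?_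
    intro ρ hρ _hMρ
    have hρpos : 0 < ρ := lt_of_lt_of_le (div_pos hw hK) hρ.1
    exact hmix ρ ⟨hρpos, lt_of_lt_of_le hρ.2 (hws.trans hrs_r₀.le)⟩
  have hTI := cknC_typeI_of_windowStep u x₀ T M₀ K rs hK hrs_pos hM₀ step
  exact hsup (K ^ 2 * M₀) T hT u p hcl hLH hdec x₀ ⟨rs, hrs_pos, hTI⟩

end Summit.NavierStokesRegularity.NavierStokesRegularity.Theorems.SequentialTypeIExclusion.Registered

end
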